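/-
PORT (pub-hodgecm2, COR-CM cell; slot b19 = executor of row Fg6, successor of model-2) of the stage-1 package file
`HodgeCMPerL/HodgeCM/Proofs/Pohlmann/WeightLinesMonomial.lean` (pub-hodgecm HOME/lean, bytes of record md5 558476789224, 251 lines),
declarations VERBATIM, followed by the first two theorems `finrank_weightSpace_succ`, `finrank_weightSpace` of
`HodgeCMPerL/HodgeCM/Proofs/Pohlmann/WeightLines.lean` (md5 a7483f5a72e3, source ll. 70–110) VERBATIM (the rest of that file —
Pohlmann's Thm 3.1 in literal basis form — is off the COR-CM chain and not ported here; a later port of it imports this module and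
omits those two).  Edits: the package import `Proofs.Pohlmann.PohlmannEq` re-pointed to `Proofs.Pohlmann.WeightHodge` (the module that
declares the two lemmas used from that cone, `iSupIndep_weightSpace` and `sum_eq_sum_wtOf`; one landing level lower), namespace token
`HodgeCM` ↦ `Summit.HodgeConjecture.CorCM`, linter fixes.  Generator: pub-hodgecm2-p1 portkit `build_kit.py` (via model-2's run).
-/
import Summits.HodgeConjecture.CorCM.Proofs.Pohlmann.WeightHodge
import Mathlib.LinearAlgebra.ExteriorPower.Basis
import Mathlib.RingTheory.Flat.Basic
import Mathlib.LinearAlgebra.FiniteDimensional.Lemmas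

/-!
# Hodge-weight spaces are lines, I: dimensions and the monomial spans `N_T`

First half of the former `WeightLines.lean` (pohl-g3), split at its section boundary `end CM` under the tree's 400-line rule
(lean/CONVENTIONS.md §2); every declaration below is the source's, verbatim.  Contents: the linear algebra of
`namespace Summit.HodgeConjecture.CorCM.Pohlmann` (finite sums of lines, independent families of subspaces and dimension counts); the dimensions
`finrank_coh_one_prodFin`, `finrank_coh_one_cmProd` (`dim H¹(A′, ℚ) = (n+1)[F:ℚ]`, M21 + M22) and `finrank_cohC_succ`
(`dim_ℂ H^{k+1} = C(dim H¹, k+1)` under N1 `CupExterior`); `section CM`: the monomial spans `N_T = monoSpan` of the eigen-monomials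
of `WeightSpan.lean`, `N_T ⊆ V_T`, `Σ_T N_T = H^{k+1}(A′, ℂ)`, `V_T = N_T` (`weightSpace_eq_monoSpan`), `dim N_T ≤ 1`, and `N_T = 0`
off the weights with `Σ_j |T_j| = k + 1`.  The headline consequences (weight spaces are lines; the literal basis form of
Gao–Ullmo Thm 3.1 "(Pohlmann)", `PohlmannTheorem31`) are in `WeightLines.lean`, which imports this file and keeps the module name.
-/


noncomputable section

open scoped TensorProduct NumberField

namespace Summit.HodgeConjecture.CorCM

/-! ## Linear algebra -/
namespace Pohlmann

/-- The dimension of a finite independent sum of subspaces is the sum of the dimensions. -/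
theorem finrank_iSup_eq_sum {K V : Type*} [DivisionRing K] [AddCommGroup V] [Module K V] [FiniteDimensional K V]
    {ι : Type*} [Fintype ι] (p : ι → Submodule K V) (hp : iSupIndep p) :
    Module.finrank K ↥(⨆ i, p i) = ∑ i, Module.finrank K (p i) := by
  classical
  suffices h : ∀ s : Finset ι, Module.finrank K ↥(⨆ i ∈ s, p i) = ∑ i ∈ s, Module.finrank K (p i) by
    have e : (⨆ i, p i) = ⨆ i ∈ (Finset.univ : Finset ι), p i :=
      le_antisymm (iSup_le fun i => le_iSup₂ (f := fun i (_ : i ∈ (Finset.univ : Finset ι)) => p i) i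
        (Finset.mem_univ i)) (iSup₂_le fun i _ => le_iSup p i)
    rw [e]
    exact h _
  intro s
  induction s using Finset.induction_on with
  | empty =>
    have e : (⨆ i ∈ (∅ : Finset ι), p i) = ⊥ := by simp
    rw [e, finrank_bot, Finset.sum_empty]
  | insert a s ha ih =>
    rw [Finset.iSup_insert, Finset.sum_insert ha, ← ih]
    have hdis : p a ⊓ (⨆ i ∈ s, p i) = ⊥ :=
      disjoint_iff.mp (hp.disjoint_biSup (y := (s : Set ι)) (fun h => ha (Finset.mem_coe.mp h)))
    have h2 := Submodule.finrank_sup_add_finrank_inf_eq (p a) (⨆ i ∈ s, p i)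
    rwa [hdis, finrank_bot, add_zero] at h2

/-- A line has dimension at most one. -/
theorem finrank_span_singleton_le (K : Type*) {V : Type*} [DivisionRing K] [AddCommGroup V] [Module K V] (v : V) :
    Module.finrank K ↥(K ∙ v) ≤ 1 := by
  have h := finrank_span_finset_le_card (R := K) (M := V) {v}
  rwa [Finset.coe_singleton, Finset.card_singleton] at h

/-- Counting weights: the functions `T : Fin (n+1) → Finset E` with `Σ_j |T j| = m` inject into the `m`-subsets of
`Σ_j E`, so there are at most `C((n+1)|E|, m)` of them. -/
theorem card_filter_sum_card_eq_le (E : Type*) [Fintype E] [DecidableEq E] (n m : ℕ) :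
    (Finset.univ.filter fun T : Fin (n + 1) → Finset E => (∑ j, (T j).card) = m).card ≤
      ((n + 1) * Fintype.card E).choose m := by
  classical
  have h := Finset.card_le_card_of_injOn
    (s := Finset.univ.filter fun T : Fin (n + 1) → Finset E => (∑ j, (T j).card) = m)
    (t := Finset.powersetCard m (Finset.univ : Finset (Σ _ : Fin (n + 1), E)))
    (fun T => Finset.univ.sigma T) ?_ ?_
  · rwa [Finset.card_powersetCard, Finset.card_univ, Fintype.card_sigma, Finset.sum_const, Finset.card_univ,
      Fintype.card_fin, smul_eq_mul] at h
  · intro T hT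
    have hT' : (∑ j, (T j).card) = m := (Finset.mem_filter.mp (Finset.mem_coe.mp hT)).2
    refine Finset.mem_coe.mpr (Finset.mem_powersetCard.mpr ⟨Finset.subset_univ _, ?_⟩)
    rw [Finset.card_sigma, hT']
  · intro T _ T' _ hTT'
    funext j
    ext τ
    have h1 := congrArg (fun s : Finset (Σ _ : Fin (n + 1), E) => (⟨j, τ⟩ : Σ _ : Fin (n + 1), E) ∈ s) hTT'
    simpa [Finset.mem_sigma] using h1

end Pohlmann

open Literature.AlgebraicGeometry.Motives (CMType)
open Summit.HodgeConjecture.CorCM.Pohlmann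

namespace Universe

variable {U : Universe}

/-! ## Dimensions of `H¹(A′)` and `H^{k+1}(A′)` -/

/-- `dim H¹(∏_{i ≤ n} X_i, ℚ) = Σ_i dim H¹(X_i, ℚ)` (M21 `kunneth1`, induction on `n`). -/
theorem finrank_coh_one_prodFin (M : U.ModelAxioms) : ∀ (n : ℕ) (X : Fin (n + 1) → U.Var),
    Module.finrank ℚ (U.Coh (U.prodFin n X) 1) = ∑ i, Module.finrank ℚ (U.Coh (X i) 1)
  | 0, X => by rw [Fin.sum_univ_one]; rfl
  | n + 1, X => by
    rw [Fin.sum_univ_castSucc, ← finrank_coh_one_prodFin M n (fun i => X i.castSucc), ← Module.finrank_prod,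
      (LinearEquiv.ofBijective _ (M.kunneth1 (U.prodFin n fun i => X i.castSucc) (X (Fin.last (n + 1))))).finrank_eq]
    rfl

/-- `dim H¹(A′, ℚ) = (n+1)·[F:ℚ]` for `A′ = ∏_{j ≤ n} A_{(F,Θ_j)}` (M21 + M22 `H1_rank`). -/
theorem finrank_coh_one_cmProd (M : U.ModelAxioms) (F : CMField) {n : ℕ} (Θ : Fin (n + 1) → CMType F) :
    Module.finrank ℚ (U.Coh (U.cmProd F Θ) 1) = (n + 1) * Module.finrank ℚ F := by
  show Module.finrank ℚ (U.Coh (U.prodFin n fun j => U.cmAV F (Θ j)) 1) = _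
  rw [finrank_coh_one_prodFin M n, Finset.sum_congr rfl fun j _ => M.H1_rank F (Θ j), Finset.sum_const,
    Finset.card_univ, Fintype.card_fin, smul_eq_mul]

/-- `dim_ℂ H^{k+1}(X, ℂ) = C(dim H¹(X, ℚ), k+1)` when `⋀^{k+1} H¹ ≅ H^{k+1}` (N1 `CupExterior`; Mathlib's
`exteriorPower.finrank_eq`). -/
theorem finrank_cohC_succ {X : U.Var} {k : ℕ} (hE : U.CupExterior X k) :
    Module.finrank ℂ (U.CohC X (k + 1)) = (Module.finrank ℚ (U.Coh X 1)).choose (k + 1) := by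
  obtain ⟨e, he, -⟩ := hE
  rw [Module.finrank_baseChange, ← (LinearEquiv.ofBijective e he).finrank_eq, exteriorPower.finrank_eq]

section CM

variable {F : CMField} {n : ℕ} {Θ : Fin (n + 1) → CMType F}
  (x : (j : Fin (n + 1)) → ((F : Type) →+* ℂ) → U.CohC (U.cmAV F (Θ j)) 1)

/-! ## The monomial spans `N_T` -/

variable (U) in
/-- `N_T` = the span of the eigen-monomials `fmono x k p` with distinct entries (`p` injective) and weight
`wtOf k p = T`. -/
def monoSpan (k : ℕ) (T : Fin (n + 1) → Finset ((F : Type) →+* ℂ)) : Submodule ℂ (U.CohC (U.cmProd F Θ) (k + 1)) :=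
  Submodule.span ℂ (U.fmono x k '' {p | Function.Injective p ∧ wtOf k p = T})

/-- `N_T ⊆ V_T` (injective eigen-monomials are weight vectors, gen 2 `isWeightVector_fmono`). -/
theorem monoSpan_le_weightSpace (M : U.ModelAxioms) (hx : ∀ j τ, x j τ ∈ U.eigenLine F (Θ j) τ) (k : ℕ)
    (T : Fin (n + 1) → Finset ((F : Type) →+* ℂ)) : U.monoSpan x k T ≤ U.weightSpace F Θ T (k + 1) := by
  refine Submodule.span_le.2 ?_
  rintro _ ⟨p, ⟨hp, rfl⟩, rfl⟩
  exact (mem_weightSpace_iff _ _ _ _ _).2 (isWeightVector_fmono x M hx k p hp)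

/-- `Σ_T N_T = H^{k+1}(A′, ℂ)` when the `x_j` span (N1 + Künneth, gen 2 `span_fmono_eq_top`). -/
theorem iSup_monoSpan_eq_top (M : U.ModelAxioms) {k : ℕ} (hE : U.CupExterior (U.cmProd F Θ) k)
    (hsp : ∀ j, Submodule.span ℂ (Set.range (x j)) = ⊤) : ⨆ T, U.monoSpan x k T = ⊤ := by
  rw [eq_top_iff, ← span_fmono_eq_top x M hE hsp, Submodule.span_le]
  rintro _ ⟨p, rfl⟩
  by_cases hp : Function.Injective p
  · exact Submodule.mem_iSup_of_mem (wtOf k p) (Submodule.subset_span ⟨p, ⟨hp, rfl⟩, rfl⟩)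
  · rw [fmono_eq_zero_of_not_injective x hE p hp]
    exact zero_mem _

/-- **`V_S = N_S`**: a weight vector is a combination of the injective eigen-monomials of its own weight
(decompose along `H^{k+1} = N_S + Σ_{T ≠ S} N_T` and use the independence of the `V_T`). -/
theorem weightSpace_eq_monoSpan (M : U.ModelAxioms) (hx : ∀ j τ, x j τ ∈ U.eigenLine F (Θ j) τ) {k : ℕ}
    (hE : U.CupExterior (U.cmProd F Θ) k) (hsp : ∀ j, Submodule.span ℂ (Set.range (x j)) = ⊤)
    (S : Fin (n + 1) → Finset ((F : Type) →+* ℂ)) :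
    U.weightSpace F Θ S (k + 1) = U.monoSpan x k S := by
  refine le_antisymm ?_ (monoSpan_le_weightSpace x M hx k S)
  intro z hz
  have hz' : z ∈ ⨆ T, U.monoSpan x k T := by rw [iSup_monoSpan_eq_top x M hE hsp]; trivial
  rw [iSup_split_single (U.monoSpan x k) S, Submodule.mem_sup] at hz'
  obtain ⟨y, hy, w, hw, rfl⟩ := hz'
  have hw' : w ∈ ⨆ (T) (_ : T ≠ S), U.weightSpace F Θ T (k + 1) :=
    (iSup₂_mono fun T _ => monoSpan_le_weightSpace x M hx k T) hw
  have hwS : w ∈ U.weightSpace F Θ S (k + 1) := by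
    have h := Submodule.sub_mem _ hz (monoSpan_le_weightSpace x M hx k S hy)
    rwa [add_sub_cancel_left] at h
  have hw0 : w = 0 :=
    (Submodule.disjoint_def.1 (iSupIndep_def.1 (iSupIndep_weightSpace M (k + 1)) S)) w hwS hw'
  rw [hw0, add_zero]
  exact hy

/-! ## `dim N_T ≤ 1`, and `N_T = 0` off the size-`(k+1)` weights -/

omit x in
/-- An injective index map `p` has `Σ_j |(wtOf k p) j| = k + 1`. -/
theorem sum_card_wtOf {k : ℕ} (p : Fin (k + 1) → Fin (n + 1) × ((F : Type) →+* ℂ)) (hp : Function.Injective p) :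
    (∑ j, (wtOf k p j).card) = k + 1 := by
  have h := sum_eq_sum_wtOf p hp fun _ _ => (1 : ℤ)
  simp only [Finset.sum_const, Finset.card_univ, Fintype.card_fin, nsmul_eq_mul, mul_one] at h
  exact_mod_cast h.symm

/-- `N_T = 0` unless `Σ_j |T_j| = k + 1`. -/
theorem monoSpan_eq_bot_of_sum_card_ne {k : ℕ} {T : Fin (n + 1) → Finset ((F : Type) →+* ℂ)}
    (hT : (∑ j, (T j).card) ≠ k + 1) : U.monoSpan x k T = ⊥ := by
  rw [monoSpan, Submodule.span_eq_bot]
  rintro _ ⟨p, ⟨hp, rfl⟩, rfl⟩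
  exact absurd (sum_card_wtOf p hp) hT

omit x in
/-- Two injective index maps with the same weight differ by a permutation of the slots. -/
theorem exists_perm_of_wtOf_eq {k : ℕ} {p p' : Fin (k + 1) → Fin (n + 1) × ((F : Type) →+* ℂ)}
    (hp' : Function.Injective p') (h : wtOf k p = wtOf k p') :
    ∃ π : Equiv.Perm (Fin (k + 1)), p' = p ∘ π := by
  classical
  have hmem : ∀ i, ∃ l, p l = p' i := by
    intro i
    have hi : (p' i).2 ∈ wtOf k p (p' i).1 := by
      rw [h]
      exact Finset.mem_image.mpr ⟨i, Finset.mem_filter.mpr ⟨Finset.mem_univ _, rfl⟩, rfl⟩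
    obtain ⟨l, hl, hl2⟩ := Finset.mem_image.mp hi
    exact ⟨l, Prod.ext (Finset.mem_filter.mp hl).2 hl2⟩
  choose g hg using hmem
  have hginj : Function.Injective g := fun i i' hii' => hp' (by rw [← hg i, ← hg i', hii'])
  refine ⟨Equiv.ofBijective g (Finite.injective_iff_bijective.mp hginj), funext fun i => ?_⟩
  simp [hg i]

/-- Permuting the slots multiplies an eigen-monomial by a sign (N1: `cupPowC_swap`), so it stays on the same line. -/
theorem fmono_comp_perm_mem_span {k : ℕ} (hE : U.CupExterior (U.cmProd F Θ) k) (π : Equiv.Perm (Fin (k + 1))) :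
    ∀ p : Fin (k + 1) → Fin (n + 1) × ((F : Type) →+* ℂ), U.fmono x k (p ∘ π) ∈ ℂ ∙ U.fmono x k p := by
  induction π using Equiv.Perm.swap_induction_on with
  | one => intro p; exact Submodule.mem_span_singleton_self _
  | swap_mul f a b hab ih =>
    intro p
    have h1 : p ∘ ⇑(Equiv.swap a b * f) = (p ∘ ⇑(Equiv.swap a b)) ∘ ⇑f := rfl
    rw [h1]
    refine (Submodule.span_singleton_le_iff_mem _ _).mpr ?_ (ih (p ∘ ⇑(Equiv.swap a b)))
    have h2 : U.fmono x k (p ∘ ⇑(Equiv.swap a b)) = -U.fmono x k p := by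
      rw [fmono_eq, fmono_eq]
      exact cupPowC_swap hE (U.fvec x ∘ p) hab
    rw [h2]
    exact Submodule.neg_mem _ (Submodule.mem_span_singleton_self _)

/-- `dim N_T ≤ 1`. -/
theorem finrank_monoSpan_le_one {k : ℕ} (hE : U.CupExterior (U.cmProd F Θ) k)
    (T : Fin (n + 1) → Finset ((F : Type) →+* ℂ)) : Module.finrank ℂ (U.monoSpan x k T) ≤ 1 := by
  by_cases hne : ∃ p₀ : Fin (k + 1) → Fin (n + 1) × ((F : Type) →+* ℂ), Function.Injective p₀ ∧ wtOf k p₀ = T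
  · obtain ⟨p₀, hp₀, rfl⟩ := hne
    have hle : U.monoSpan x k (wtOf k p₀) ≤ ℂ ∙ U.fmono x k p₀ := by
      refine Submodule.span_le.mpr ?_
      rintro _ ⟨p, ⟨hp, hpT⟩, rfl⟩
      obtain ⟨π, rfl⟩ := exists_perm_of_wtOf_eq hp hpT.symm
      exact fmono_comp_perm_mem_span x hE π p₀
    exact (Submodule.finrank_mono hle).trans (finrank_span_singleton_le ℂ _)
  · have h0 : U.monoSpan x k T = ⊥ := by
      rw [monoSpan, Submodule.span_eq_bot]
      rintro _ ⟨p, hp, rfl⟩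
      exact absurd ⟨p, hp⟩ hne
    rw [h0, finrank_bot]
    exact Nat.zero_le _

end CM

/-! ## The weight spaces are lines (first two theorems of the package's `WeightLines.lean`) -/

section Lines


variable {F : CMField} {n : ℕ} {Θ : Fin (n + 1) → CMType F}

/-- **Weight spaces in positive degree are lines**: `dim_ℂ V_S = 1` if `Σ_j |S_j| = k + 1`, and `V_S = 0` otherwise
(`ModelAxioms` + N1). -/
theorem finrank_weightSpace_succ (M : U.ModelAxioms) (hN1 : U.Fact_cupExterior) (k : ℕ)
    (S : Fin (n + 1) → Finset ((F : Type) →+* ℂ)) :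
    Module.finrank ℂ (U.weightSpace F Θ S (k + 1)) = if (∑ j, (S j).card) = k + 1 then 1 else 0 := by
  classical
  obtain ⟨β, -, hβ⟩ := exists_integral_injective_eval F
  choose x hx _hx0 hsp using fun j => exists_eigenbasis M F (Θ j) β hβ
  have hE := hN1 F n Θ k
  -- termwise bound `dim V_T ≤ c_T`
  let c : (Fin (n + 1) → Finset ((F : Type) →+* ℂ)) → ℕ := fun T => if (∑ j, (T j).card) = k + 1 then 1 else 0
  have hle : ∀ T, Module.finrank ℂ (U.weightSpace F Θ T (k + 1)) ≤ c T := by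
    intro T
    rw [weightSpace_eq_monoSpan x M hx hE hsp T]
    by_cases hT : (∑ j, (T j).card) = k + 1
    · simp only [c, hT, if_true]
      exact finrank_monoSpan_le_one x hE T
    · simp only [c, hT, if_false]
      rw [monoSpan_eq_bot_of_sum_card_ne x hT, finrank_bot]
  -- total dimension `Σ_T dim V_T = dim H^{k+1}(A′, ℂ) = C((n+1)[F:ℚ], k+1)`
  have htot : ∑ T, Module.finrank ℂ (U.weightSpace F Θ T (k + 1)) =
      ((n + 1) * Module.finrank ℚ F).choose (k + 1) := by
    rw [← finrank_iSup_eq_sum _ (iSupIndep_weightSpace M (k + 1)), iSup_weightSpace_succ M hN1 k, finrank_top,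
      finrank_cohC_succ hE, finrank_coh_one_cmProd M F Θ]
  -- and there are at most that many weights of size `k + 1`
  have hc : ∑ T, c T ≤ ((n + 1) * Module.finrank ℚ F).choose (k + 1) := by
    rw [← Finset.card_filter, ← NumberField.Embeddings.card (F : Type) ℂ]
    exact card_filter_sum_card_eq_le ((F : Type) →+* ℂ) n (k + 1)
  have heq : ∑ T, Module.finrank ℂ (U.weightSpace F Θ T (k + 1)) = ∑ T, c T :=
    le_antisymm (Finset.sum_le_sum fun T _ => hle T) (hc.trans htot.symm.le)
  exact (Finset.sum_eq_sum_iff_of_le fun T _ => hle T).mp heq S (Finset.mem_univ S)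

/-- The same in every positive degree `m`. -/
theorem finrank_weightSpace (M : U.ModelAxioms) (hN1 : U.Fact_cupExterior) {m : ℕ} (hm : 0 < m)
    (S : Fin (n + 1) → Finset ((F : Type) →+* ℂ)) :
    Module.finrank ℂ (U.weightSpace F Θ S m) = if (∑ j, (S j).card) = m then 1 else 0 := by
  cases m with
  | zero => exact absurd hm (lt_irrefl 0)
  | succ k => exact finrank_weightSpace_succ M hN1 k S


end Lines

end Universe

end Summit.HodgeConjecture.CorCM

end
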